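import Literature.AlgebraicGeometry.ModuliOfAbelianVarieties.SiegelAdelicMarkingIdealQuotient   -- ★ (S2b) `SiegelAdelicMarking.exists_marking_of_idealKernel`
import Literature.AlgebraicGeometry.AbelianSchemes.SerreCoverRowsOfPresentation                 -- ★ `AbelianSchemeOver.serreCover_rows_of_presentation` ((t1)(t1′)(surj)(t2)(t4), any base)
import Literature.AlgebraicGeometry.AbelianSchemes.SerreTwistRelDim                             -- ★ `AbelianSchemeOver.isOfRelDim_serreTensor`
import Literature.AlgebraicGeometry.AbelianSchemes.DualIsogenyDegree                            -- ★ `AbelianSchemeOver.homOfIsMonHom` (a `k`-group-scheme hom as a morphism of abelian varieties)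
import Literature.AlgebraicGeometry.Motives.AlgPointsMapSurjectiveAlgClosed                      -- ★ `AlgPoints.map_surjective_of_surjective_of_isAlgClosed'`
import Literature.NumberTheory.NumberFields.SerreTensorPresentationOfIdeal                      -- ★ `SerrePresentation.exists_serrePresentation_of_ideal_of_natCast_mem`
import HarnessLib

/-!
# The Serre cover `A → A ⊗_{𝒪_F} 𝔞⁻¹` of ONE marked complex fibre: rows AND the marking of the target

Topic `AlgebraicGeometry/ModuliOfAbelianVarieties`; namespace `Literature.AlgebraicGeometry.ModuliOfAbelianVarieties`.  THEOREMS ONLY (no definition,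
no named fact, no instance, no notation, no `sorry`).  Cell `hodgecm-mathlib`, FLOOR 0, P6 «MOD programme» (crux hLiu418 = stmt-HodgeConjecture-24832, `--supports`,
count-neutral); line L4, (S8) sheet-line closer `Lines/F0_P6a_StubESHEET.lean`, road B′ «Serre tensor per complex fibre», DEAL #32′ §2 «MARKING LAYER» (LA4-plan (g2)
08:03:09Z ∕ 08:10:48Z), head (F1) as cut by LA4-p03 (g2) 07:59:54Z.

SETTING ([Shimura1998] §18.6 proof, pp. 124–127: the conjugate `A^σ` of a CM-marked abelian variety is `A ⊗ 𝔞⁻¹ = ℂ^g ∕ 𝔞⁻¹Λ` with «`r` the restriction of `ξ ∘ q`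
to `K∕𝔞`»; [Milne2005ShimuraVarieties] §6 Thm. 6.11 and p. 75; [Conrad2004GrossZagier] §7 Thm. 7.5; [RapoportSmithlingZhang2020Diagonal] §3.2 p. 11 and §4.3 (4.23)
p. 21).  `A` is an abelian scheme over `Spec ℂ` of relative dimension `g` with an `𝒪_F`-action `act` (`F` a number field), whose complex points are MARKED by the
Siegel point `[J(Z), r′]` (★ `SiegelAdelicMarking`: torsion parametrisation `u = m.r : ℚ^{2g} → A(ℂ)`, kernel `Λ_{r′}`) so that the action READS through the
marking as rational matrices `M : 𝒪_F → M_{2g}(ℚ)` (`ι(x)(u v) = u(M x · v)` — the last clause of the P6 σ1 organ `Reads`, at the integer frame `C.Mρ a`); `𝔞 ≠ 0`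
an integral ideal containing the natural number `n ≠ 0`, acting integrally on `Λ_{r′}`; and `r` an adelic point cutting out `𝔞⁻¹Λ_{r′} := {v | ∀ x ∈ 𝔞, M x·v ∈ Λ_{r′}}`
(hypothesis `hr` — «`Λ_r = 𝔞⁻¹Λ_{r′}`», the (K) lattice identity, supplied by the caller).  THEN (§2): for a Serre presentation `(E′, P, Q)` of `𝔞` with scalar `n`
(★ `exists_serrePresentation_of_ideal_of_natCast_mem`), the Serre tensor `B := A ⊗_{𝒪_F} 𝔞⁻¹ := serreTensor act E′` with its cover `c₀ := ψ_P = serreTranslate act E′ P`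
has (i) relative dimension `g` (★ `isOfRelDim_serreTensor`), (ii) the five presentation-only cover rows (t1)(t1′)(surj)(t2)(t4) of ★ `serreCover_rows_of_presentation`
VERBATIM, and (iii) its complex points are MARKED by `[J(Z), r]` — the SAME complex structure — with torsion parametrisation `u_B = c₀ ∘ u` (★ (S2b)
`SiegelAdelicMarking.exists_marking_of_idealKernel`, fed with `hker :=` (t1′) at the `Spec ℂ`-points, `hsurj :=` (surj) lifted to ℂ-points by ★
`AlgPoints.map_surjective_of_surjective_of_isAlgClosed'`, `hdim :=` (i)).  §1 is the dimension bookkeeping `dim (B_ℂ) = g`; §3 re-reads (t2) for an ideal `𝔟` with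
`𝔞𝔟 ⊆ (n)` (in use `𝔟 := c•𝔞`, `(n) = 𝔞·c•𝔞` — row (a) of the sheet-line junction).  Consumers: the B′ glue `coverKerBody_of_cover_onto_iso` (LA4-p01 (g3)) takes
(t1)(t1′)(t2)(t4) in exactly this token shape with `actB := (serreAction act E′).i`; the pairing∕level rows (t3)(t5) are READ through the two markings `(m, mB, u_B = c₀ ∘ u)`
by ★ `SiegelAdelicMarkingCoverPairingReading` ∕ ★ `SiegelAdelicMarkingCoverLevelReading` (LA5-p02 (g4)); the admissible-marking ⇒ tuple-iso move (DEAL #34) eats `mB`.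

* §1 `AbelianSchemeOver.dim_toAffine_toAbelianVariety_eq_of_isOfRelDim` — `B.IsOfRelDim g → dim B.toAffine.toAbelianVariety = g` over `Spec Ω` (any universe).
* §2 **`SiegelAdelicMarking.exists_serreTensor_cover_marked_of_reading`** — THE HEAD.
* §3 `forall_mul_mem_span_of_mul_le` — the (t2) side condition `∀ x ∈ 𝔞, b·x ∈ (n)` for `b ∈ 𝔟` read off `𝔞 * 𝔟 ≤ (n)` (in use `𝔟 := c•𝔞`).
Budgets: default heartbeats.

References: [Shimura1998] G. Shimura, *Abelian Varieties with Complex Multiplication and Modular Functions* (1998), §18.3 pp. 122–123 and §18.6 pp. 124–127;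
[Milne2005ShimuraVarieties] J. S. Milne, *Introduction to Shimura varieties* (2005), §6 Thm. 6.11 p. 74 and p. 75; [Conrad2004GrossZagier] B. Conrad, *Gross–Zagier
revisited* (2004), §7 Thm. 7.5; [RapoportSmithlingZhang2020Diagonal] M. Rapoport, B. Smithling, W. Zhang (2020), §3.2 (p. 11) and §4.3 (4.23) (p. 21);
[MumfordAV1970] D. Mumford, *Abelian Varieties* (1970), §7 Thm. 4 (p. 72); [GortzWedhorn2020] U. Görtz, T. Wedhorn, *Algebraic Geometry I* (2nd ed. 2020), Remark 16.54.
HC_CM is proved only modulo the printed citations (2 remaining named inputs hLiu418 24832, h413 24833) until rung 0 closes — count-neutral.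
-/

set_option autoImplicit false

noncomputable section

universe u

open CategoryTheory CategoryTheory.Limits AlgebraicGeometry Matrix
open scoped MonObj NumberField
open Literature.AlgebraicGeometry.Motives (SchemeOver ComplexPoints AlgPoints specOver AbelianVariety)
open Literature.AlgebraicGeometry.AbelianSchemes (AbelianSchemeOver)
open Literature.AlgebraicGeometry.AbelianSchemes.AbelianSchemeOver (serreTensor serreTranslate serreAction homOfIsMonHom)
open Literature.NumberTheory.Automorphic (siegelUpperHalfSpace)
open Literature.NumberTheory.Adeles (latticeOfGL)

/-! ### §1 Dimension bookkeeping over `Spec Ω` -/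

namespace Literature.AlgebraicGeometry.AbelianSchemes.AbelianSchemeOver

/-- `dim B_Ω = g` for an abelian scheme `B → Spec Ω` of relative dimension `g`, read on the abelian variety `B.toAffine.toAbelianVariety` (uniqueness of the relative
dimension of a smooth morphism with non-empty source; ★ `AbelianScheme.isOfRelDim_dim`; universe-polymorphic twin of ★ `dim_toAbelianVariety_of_isOfRelDim`).
[cite: GortzWedhorn2020, Remark 16.54 (p. 539)] -/
theorem dim_toAffine_toAbelianVariety_eq_of_isOfRelDim {Ω : Type u} [Field Ω] (B : AbelianSchemeOver (Spec (.of Ω))) {g : ℕ}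
    (h : B.IsOfRelDim g) : B.toAffine.toAbelianVariety.dim = g := by
  have h₂ : SmoothOfRelativeDimension B.toAffine.toAbelianVariety.dim B.toAffine.X.hom := B.toAffine.isOfRelDim_dim
  haveI : Nonempty B.toAffine.X.left := ⟨Motives.AbelianVariety.origin B.toAffine.toAbelianVariety⟩
  exact Motives.AbelianVarietyProofs.eq_of_smoothOfRelativeDimension _ h₂ h

end Literature.AlgebraicGeometry.AbelianSchemes.AbelianSchemeOver

namespace Literature.AlgebraicGeometry.ModuliOfAbelianVarieties

open SiegelModuli
open Literature.AlgebraicGeometry.AbelianSchemes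

/-! ### §2 THE HEAD: the Serre cover of a marked complex fibre whose action reads through the marking — rows and the marking of the target -/

-- as the ★ Serre-tensor files: `Over`∕`Scheme` wrappers are semireducible
set_option backward.isDefEq.respectTransparency false in
/-- **(F1) «THE SERRE COVER `ψ_P : A → A ⊗_{𝒪_F} 𝔞⁻¹` OF A MARKED COMPLEX FIBRE WHOSE ACTION READS THROUGH THE MARKING: ROWS (t1)(t1′)(surj)(t2)(t4) AND THE
`[J(Z), r]`-MARKING OF THE TARGET WITH `u_B = ψ_P ∘ u`.»**  For `A → Spec ℂ` abelian of relative dimension `g` with `𝒪_F`-action `act`, a marking `m` of `A(ℂ)` by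
`[J(Z), r′]` through which `act` reads as `M : 𝒪_F → M_{2g}(ℚ)` (`hread`), an ideal `𝔞 ≠ 0` with `n ∈ 𝔞`, `n ≠ 0`, acting integrally on `Λ_{r′}` (`hint`), and an
adelic `r` with `Λ_r = 𝔞⁻¹Λ_{r′}` (`hr`): there are a Serre presentation `(E′, P, Q)` of `𝔞` with scalar `n` and a marking `mB` of `(A ⊗ 𝔞⁻¹)(ℂ)` by `[J(Z), r]`
such that `A ⊗ 𝔞⁻¹ := serreTensor act E′` has relative dimension `g`, the cover `c₀ := serreTranslate act E′ P` satisfies (t1) (two-sided presentation: `c₀ d = ι(x)`,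
`d c₀ = ι_B(x)` for `x ∈ 𝔞`), (t1′) (`t c₀ = 1 ↔ ∀ x ∈ 𝔞, t ι(x) = 1` on all `T`-points), (surj), (t2) (`c₀ ι_B(y) = f ι_B(n)` whenever `y𝔞 ⊆ (n)`), (t4)
(`𝒪_F`-equivariance), and `mB.r v = c₀ (m.r v)`.  Shimura՚s «`A^σ = A ⊗ 𝔞⁻¹` is `ℂ^g ∕ 𝔞⁻¹Λ`, marked by the translate» on one complex fibre.
[cite: Shimura1998, §18.6 pp. 124–127] [cite: Milne2005ShimuraVarieties, §6 Thm. 6.11 p. 74 and p. 75] [cite: Conrad2004GrossZagier, §7 (Thm. 7.5)]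
[cite: RapoportSmithlingZhang2020Diagonal, §3.2 (p. 11) and §4.3 (4.23) (p. 21)] -/
theorem SiegelAdelicMarking.exists_serreTensor_cover_marked_of_reading {g : ℕ} {δ : Fin g → ℕ} (hδ : IsPolarizationType δ)
    (Z : Matrix (Fin g) (Fin g) ℂ) (hZ : Z ∈ siegelUpperHalfSpace g) (r' r : gspFinAdelic δ)
    {F : Type} [Field F] [NumberField F]
    (A : AbelianSchemeOver (Spec (.of ℂ))) [IsCommMonObj A.X] (act : A.RingAction (𝓞 F)) (hA : A.IsOfRelDim g)
    (m : SiegelAdelicMarking ⟨jOfSiegel δ Z, SiegelComplexRecordSystem.jOfSiegel_mem_C0pm hδ.1 hZ⟩ r' A.toAffine.toAbelianVariety)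
    (M : 𝓞 F → Matrix (Fin g ⊕ Fin g) (Fin g ⊕ Fin g) ℚ)
    (hread : ∀ (x : 𝓞 F) (v : Fin g ⊕ Fin g → ℚ), AlgPoints.map (act.i x) (m.r v) = m.r (M x *ᵥ v))
    (𝔞 : Ideal (𝓞 F)) (h𝔞 : 𝔞 ≠ ⊥) {n : ℕ} (hn0 : n ≠ 0) (hn : ((n : ℕ) : 𝓞 F) ∈ 𝔞)
    (hint : ∀ v : Fin g ⊕ Fin g → ℚ, v ∈ latticeOfGL (r' : GL (Fin g ⊕ Fin g) finAdeleQ) →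
      ∀ x ∈ 𝔞, M x *ᵥ v ∈ latticeOfGL (r' : GL (Fin g ⊕ Fin g) finAdeleQ))
    (hr : ∀ v : Fin g ⊕ Fin g → ℚ, v ∈ latticeOfGL (r : GL (Fin g ⊕ Fin g) finAdeleQ) ↔
      ∀ x ∈ 𝔞, M x *ᵥ v ∈ latticeOfGL (r' : GL (Fin g ⊕ Fin g) finAdeleQ)) :
    ∃ (k : ℕ) (E' : Matrix (Fin k) (Fin k) (𝓞 F)) (hE' : E' * E' = E') (P : Matrix (Fin k) (Fin 1) (𝓞 F)) (Q : Matrix (Fin 1) (Fin k) (𝓞 F))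
      (mB : SiegelAdelicMarking ⟨jOfSiegel δ Z, SiegelComplexRecordSystem.jOfSiegel_mem_C0pm hδ.1 hZ⟩ r (serreTensor act E' hE').toAffine.toAbelianVariety),
      -- the presentation of `𝔞` with scalar `n`
      (E' * P = P ∧ Q * E' = Q ∧ Q * P = Matrix.scalar (Fin 1) ((n : ℕ) : 𝓞 F) ∧ P * Q = Matrix.scalar (Fin k) ((n : ℕ) : 𝓞 F) * E' ∧
        Ideal.span (Set.range fun j => P j 0) = 𝔞) ∧
      -- (i) relative dimension
      (serreTensor act E' hE').IsOfRelDim g ∧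
      -- (t1) two-sided Serre presentation of `𝔞`
      (∀ x ∈ 𝔞, ∃ d : (serreTensor act E' hE').X ⟶ A.X, IsMonHom d ∧
        serreTranslate act E' hE' P ≫ d = act.i x ∧ d ≫ serreTranslate act E' hE' P = (serreAction act E' hE').i x) ∧
      -- (t1′) the kernel of the cover is the `𝔞`-torsion, on all `T`-points
      (∀ ⦃T : Over (Spec (.of ℂ))⦄ (t : T ⟶ A.X), t ≫ serreTranslate act E' hE' P = 1 ↔ ∀ x ∈ 𝔞, t ≫ act.i x = 1) ∧
      -- (surj) the cover is surjective
      Function.Surjective (serreTranslate act E' hE' P).left.base ∧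
      -- (t2) upper bound through `(n) ⊇ y·𝔞`
      (∀ y : 𝓞 F, (∀ x ∈ 𝔞, y * x ∈ Ideal.span {((n : ℕ) : 𝓞 F)}) → ∃ f : A.X ⟶ (serreTensor act E' hE').X, IsMonHom f ∧
        serreTranslate act E' hE' P ≫ (serreAction act E' hE').i y = f ≫ (serreAction act E' hE').i ((n : ℕ) : 𝓞 F)) ∧
      -- (t4) `𝒪_F`-equivariance of the cover
      (∀ x : 𝓞 F, act.i x ≫ serreTranslate act E' hE' P = serreTranslate act E' hE' P ≫ (serreAction act E' hE').i x) ∧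
      -- the marking of the target reads the cover as `id` on `V_ℝ`
      (∀ v : Fin g ⊕ Fin g → ℚ, mB.r v = AlgPoints.map (serreTranslate act E' hE' P) (m.r v)) := by
  classical
  -- the presentation of `𝔞` with scalar `n`
  obtain ⟨k, E', hE', P, Q, hP, hQ, hQP, hPQ, hspan, -, -⟩ :=
    Literature.NumberTheory.NumberFields.SerrePresentation.exists_serrePresentation_of_ideal_of_natCast_mem 𝔞 h𝔞 hn
  have hN : ((n : ℕ) : 𝓞 F) ≠ 0 := by exact_mod_cast hn0
  -- the five presentation-only rows
  obtain ⟨t1, t1', hsurj, t2, t4⟩ := AbelianSchemeOver.serreCover_rows_of_presentation act E' hE' P Q hn0 hP hQ hQP hPQ hspan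
  -- (i) relative dimension
  have hdimB : (serreTensor act E' hE').IsOfRelDim g := AbelianSchemeOver.isOfRelDim_serreTensor act E' hE' P Q hn0 hP hQ hQP hPQ hA
  have hdim : (serreTensor act E' hE').toAffine.toAbelianVariety.dim = g :=
    AbelianSchemeOver.dim_toAffine_toAbelianVariety_eq_of_isOfRelDim _ hdimB
  -- the cover and the action as morphisms of complex abelian varieties
  haveI hc₀ : IsMonHom (serreTranslate act E' hE' P) := AbelianSchemeOver.isMonHom_serreTranslate act E' hE' P
  let c : A.toAffine.toAbelianVariety ⟶ (serreTensor act E' hE').toAffine.toAbelianVariety := homOfIsMonHom (serreTranslate act E' hE' P)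
  let ρ : 𝓞 F → (A.toAffine.toAbelianVariety ⟶ A.toAffine.toAbelianVariety) := fun x =>
    @homOfIsMonHom _ _ _ _ (act.i x) (act.isMonHom x)
  have hρ : ∀ x, (ρ x).hom.hom.hom = act.i x := fun x => rfl
  have hc : c.hom.hom.hom = serreTranslate act E' hE' P := rfl
  -- `hker` := (t1′) at the `ℂ`-points
  have hker : ∀ Pt : A.toAffine.toAbelianVariety.Points ℂ,
      AlgPoints.map c.hom.hom.hom Pt = 1 ↔ ∀ x ∈ (𝔞 : Set (𝓞 F)), AlgPoints.map (ρ x).hom.hom.hom Pt = 1 := fun Pt => by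
    simp only [hρ, hc, AlgPoints.map]
    exact t1' Pt
  -- `hsurj` on `ℂ`-points
  haveI : Surjective (serreTranslate act E' hE' P).left := ⟨hsurj⟩
  haveI := A.isSmooth
  have hsurjC : Function.Surjective (AlgPoints.map (L := ℂ) c.hom.hom.hom :
      A.toAffine.toAbelianVariety.Points ℂ → (serreTensor act E' hE').toAffine.toAbelianVariety.Points ℂ) := by
    rw [hc]
    exact Motives.AlgPoints.map_surjective_of_surjective_of_isAlgClosed' (k := ℂ) (L := ℂ) (serreTranslate act E' hE' P)
  -- `hread` through `ρ`
  have hread' : ∀ (x : 𝓞 F) (v : Fin g ⊕ Fin g → ℚ), AlgPoints.map (ρ x).hom.hom.hom (m.r v) = m.r (M x *ᵥ v) := fun x v => by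
    rw [hρ]; exact hread x v
  -- ★ (S2b)
  obtain ⟨mB, hmB⟩ := SiegelAdelicMarking.exists_marking_of_idealKernel hδ Z hZ r' r A.toAffine.toAbelianVariety
    (serreTensor act E' hE').toAffine.toAbelianVariety m ρ M hread' (𝔞 : Set (𝓞 F)) (fun v hv x hx => hint v hv x hx)
    (fun v => (hr v).trans (by simp only [SetLike.mem_coe])) c hdim hker hsurjC
  refine ⟨k, E', hE', P, Q, mB, ⟨hP, hQ, hQP, hPQ, hspan⟩, hdimB, t1, t1', hsurj, t2, t4, fun v => ?_⟩
  rw [hmB v, hc]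

/-! ### §3 The (t2) side condition read on an ideal `𝔟` with `𝔞𝔟 ⊆ (n)` -/

/-- (t2) re-read: if `𝔞 * 𝔟 ≤ (n)` then every `b ∈ 𝔟` satisfies `∀ x ∈ 𝔞, b * x ∈ (n)`. [cite: Shimura1998, §18.6 pp. 124–127] -/
theorem forall_mul_mem_span_of_mul_le {O : Type*} [CommRing O] {𝔞 𝔟 : Ideal O} {n : O} (h : 𝔞 * 𝔟 ≤ Ideal.span {n})
    {b : O} (hb : b ∈ 𝔟) : ∀ x ∈ 𝔞, b * x ∈ Ideal.span {n} := fun x hx => by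
  rw [mul_comm]
  exact h (Ideal.mul_mem_mul hx hb)

end Literature.AlgebraicGeometry.ModuliOfAbelianVarieties

end
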